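import Mathlib
import HarnessLib
import Summits.Ventures.LatticeQCDFlow.Exactness.NCMCGeneralSpaceEstimatorConsistency

/-!
# Asymptotic normality of the Jarzynski estimate on a general state space: the CLT and the delta-method step

HONEST FRAMING: exact (Metropolis-corrected) sampling algorithms for lattice gauge theory;
figures of merit are autocorrelation/cost numbers at stated couplings and volumes; no
continuum-physics claim.

Venture `LatticeQCDFlow` (cell pub-lqcd), topic `Exactness`; FANOUT row 13 (`eng-snf`, GEN-12).
NEW WORK of the cell (elementary asymptotic statistics on product laws, assembled from Mathlib's
central limit theorem `ProbabilityTheory.tendstoInDistribution_inv_sqrt_mul_sum_sub`, Slutsky's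
theorem `MeasureTheory.TendstoInDistribution.continuous_comp_prodMk_of_tendstoInMeasure_const`,
the strong law, and `dslope`), not a published result; nothing is cited as a fact (the "delta
method" of asymptotic statistics and C. Jarzynski, Phys. Rev. Lett. 78 (1997) 2690 are named
only).  Continuation of `NCMCGeneralSpaceEstimatorConsistency.lean` (GEN-11: the VARIANCE
`(1/ESS_F − 1)/N` of the exponential average and the strong consistency `ΔF̂_n → ΔF`), which left
"rates of convergence / CLT / the delta-method step" NOT TYPED.  Vocabulary reused verbatim:
`sampleMean`, `jarzynskiEstimate` (`JarzynskiEstimatorBias.lean`), `fwdPathLaw`, `CrooksPair`.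

## Setting and content

`μ` a probability law on records `E`, an infinite i.i.d. run carries `Measure.infinitePi (fun _ : ℕ => μ)`
on `ℕ → E`; `Ȳ_n(ω) = sampleMean g (ω 0, …, ω (n−1))`; limits in distribution are stated Mathlib-style,
against ANY real random variable `Y` (on any probability space) having the named Gaussian law.

* `identDistrib_comp_eval_infinitePi_self`, `variance_comp_eval_infinitePi`,
  `measurable_sampleMean_run`, `inv_sqrt_mul_sub_eq_sqrt_mul` — bookkeeping;
  **`tendstoInDistribution_sqrt_mul_sampleMean_sub`** — THE CLT FOR SAMPLE MEANS OF AN I.I.D. RUN: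
  for measurable `g ∈ L²(μ)`, `√n (Ȳ_n − E_μ g) →d N(0, Var_μ g)`.
* `measurable_dslope_log`, `hasLaw_const_mul_gaussianReal` — bookkeeping;
  **`tendstoInDistribution_sqrt_mul_jarzynskiEstimate_sub`** — THE DELTA-METHOD STEP: for a
  positive measurable weight `w ∈ L²(μ)` with mean `θ`,
  `√n (−log Ȳ_n − (−log θ)) →d N(0, Var_μ[w] / θ²)`.  Proof: `log Ȳ − log θ = (Ȳ − θ)·dslope log θ Ȳ`
  exactly (`sub_smul_dslope`), `dslope log θ (Ȳ_n) → θ⁻¹` almost surely (strong law + continuity of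
  `dslope log θ` at `θ`, i.e. differentiability of `log` at `θ > 0`) hence in probability, the CLT
  for `√n (Ȳ_n − θ)`, and Slutsky.
* For a Crooks pair `(κF, κR, s, e, W)` from `ν₀` to `ν₁` with `e^{−W} ∈ L²(P_F)`
  (`E_F e^{−2W} < ∞`), along `Measure.infinitePi (fun _ => P_F)` (independent forward evolutions
  from prior equilibrium):
  **`CrooksPair.tendstoInDistribution_sampleMean_exp_neg_work`** —
  `√n ((1/n) Σ_{i<n} e^{−W_i} − Z₁/Z₀) →d N(0, E_F e^{−2W} − (Z₁/Z₀)²)`;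
  **`CrooksPair.tendstoInDistribution_jarzynskiEstimate`** — ASYMPTOTIC NORMALITY OF THE FREE-ENERGY
  ESTIMATE: `√n (ΔF̂_n − ΔF) →d N(0, E_F e^{−2W} / (E_F e^{−W})² − 1)`, and
  **`CrooksPair.tendstoInDistribution_jarzynskiEstimate_dissipation`** — the same variance written
  `E_F[e^{−2(W − ΔF)}] − 1 = 1/ESS_F − 1` (`NCMCGeneralSpaceDissipation.essPop_eq_inv_dissipation`).
  Reading for the engine (`snf.estimators.free_energy`, `ess`): for independent evolutions the
  reported Kish fraction `ess/N ≈ ESS_F` IS the asymptotic relative efficiency of `dF` — the honest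
  large-`N` error bar of `dF` is `√((1/ESS_F − 1)/N)`.

Scope / NOT CLAIMED: independent evolutions only (correlated chain starts, the block jackknife and
any Berry–Esseen-type rate are not covered); no value of `ESS_F` for any concrete protocol; the
statements are limits in distribution, not finite-`N` coverage guarantees.
-/

namespace Summit.Ventures.LatticeQCDFlow.Exactness.GeneralNCMC

open MeasureTheory ProbabilityTheory Set Filter Finset
open scoped ENNReal NNReal Topology

variable {E : Type*} [MeasurableSpace E]

/-! ## The central limit theorem for the sample means of an infinite i.i.d. run -/

section IID

variable (μ : Measure E) [IsProbabilityMeasure μ]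
variable {Ω' : Type*} [MeasurableSpace Ω'] {P' : Measure Ω'} [IsProbabilityMeasure P']

/-- A coordinate of an infinite i.i.d. run, read through a measurable `g`, is distributed as `g`
under `μ`. -/
theorem identDistrib_comp_eval_infinitePi_self {g : E → ℝ} (hg : Measurable g) (i : ℕ) :
    IdentDistrib (fun ω : ℕ → E => g (ω i)) g (Measure.infinitePi fun _ : ℕ => μ) μ where
  aemeasurable_fst := (hg.comp (measurable_pi_apply i)).aemeasurable
  aemeasurable_snd := hg.aemeasurable
  map_eq := by
    rw [show (fun ω : ℕ → E => g (ω i)) = g ∘ fun ω => ω i from rfl,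
      ← Measure.map_map hg (measurable_pi_apply i), Measure.infinitePi_map_eval]

/-- … hence has the variance of `g` under `μ`. -/
theorem variance_comp_eval_infinitePi {g : E → ℝ} (hg : Measurable g) (i : ℕ) :
    Var[fun ω : ℕ → E => g (ω i); Measure.infinitePi fun _ : ℕ => μ] = Var[g; μ] :=
  (identDistrib_comp_eval_infinitePi_self μ hg i).variance_eq

/-- The sample mean of the first `n` coordinates is a measurable function of the run. -/
theorem measurable_sampleMean_run {g : E → ℝ} (hg : Measurable g) (n : ℕ) :
    Measurable fun ω : ℕ → E => sampleMean g (fun i : Fin n => ω i) := by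
  unfold sampleMean
  refine Measurable.div_const ?_ _
  refine Finset.measurable_sum _ fun i _ => ?_
  exact (hg.comp (measurable_pi_apply (i : ℕ)) : Measurable fun ω : ℕ → E => g (ω i))

/-- `(√n)⁻¹ (S − n m) = √n (S/n − m)` (both sides vanish at `n = 0`). -/
theorem inv_sqrt_mul_sub_eq_sqrt_mul (n : ℕ) (S m : ℝ) :
    (√(n : ℝ))⁻¹ * (S - n * m) = √(n : ℝ) * (S / n - m) := by
  rcases Nat.eq_zero_or_pos n with rfl | hn
  · simp
  · have hn' : (0 : ℝ) < n := by exact_mod_cast hn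
    have h1 : (√(n : ℝ))⁻¹ * (n * m) = √(n : ℝ) * m := by
      rw [← mul_assoc, inv_mul_eq_div, Real.div_sqrt]
    have h2 : √(n : ℝ) * (S / n) = (√(n : ℝ))⁻¹ * S := by
      rw [mul_div_assoc', mul_comm, mul_div_assoc, Real.sqrt_div_self]
      exact mul_comm _ _
    rw [mul_sub, mul_sub, h1, h2]

/-- **CLT for the sample means of an infinite i.i.d. run.**  For a measurable `g ∈ L²(μ)`,
`√n ((1/n) Σ_{i<n} g(ω i) − E_μ g)` converges in distribution to the centred Gaussian of variance
`Var_μ[g]` along `Measure.infinitePi (fun _ => μ)` (Mathlib's `tendstoInDistribution_inv_sqrt_mul_sum_sub`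
with `iIndepFun_infinitePi`). -/
theorem tendstoInDistribution_sqrt_mul_sampleMean_sub {g : E → ℝ} (hg : Measurable g)
    (hL2 : MemLp g 2 μ) {Y : Ω' → ℝ} (hY : HasLaw Y (gaussianReal 0 (Var[g; μ]).toNNReal) P') :
    TendstoInDistribution
      (fun (n : ℕ) (ω : ℕ → E) => √(n : ℝ) * (sampleMean g (fun i : Fin n => ω i) - ∫ a, g a ∂μ))
      atTop Y (fun _ => Measure.infinitePi fun _ : ℕ => μ) P' := by
  have hident := fun i => identDistrib_comp_eval_infinitePi μ hg i
  have hindep : iIndepFun (fun i (ω : ℕ → E) => g (ω i)) (Measure.infinitePi fun _ : ℕ => μ) :=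
    iIndepFun_infinitePi (P := fun _ : ℕ => μ) (X := fun _ : ℕ => g) fun _ => hg
  have hvar : Var[fun ω : ℕ → E => g (ω 0); Measure.infinitePi fun _ : ℕ => μ] = Var[g; μ] :=
    variance_comp_eval_infinitePi μ hg 0
  have hmean : ∫ ω, g (ω 0) ∂(Measure.infinitePi fun _ : ℕ => μ) = ∫ a, g a ∂μ :=
    integral_comp_eval_infinitePi μ hg.aestronglyMeasurable 0
  have hL2' : MemLp (fun ω : ℕ → E => g (ω 0)) 2 (Measure.infinitePi fun _ : ℕ => μ) :=
    (identDistrib_comp_eval_infinitePi_self μ hg 0).memLp_iff.2 hL2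
  have hY' : HasLaw Y (gaussianReal 0
      (Var[fun ω : ℕ → E => g (ω 0); Measure.infinitePi fun _ : ℕ => μ]).toNNReal) P' := by
    rwa [hvar]
  have clt := tendstoInDistribution_inv_sqrt_mul_sum_sub (X := fun i (ω : ℕ → E) => g (ω i))
    hY' hL2' hindep hident
  rw [hmean] at clt
  convert clt using 3 with n ω
  unfold sampleMean
  rw [Fin.sum_univ_eq_sum_range (fun i => g (ω i)) n, inv_sqrt_mul_sub_eq_sqrt_mul]

/-! ## The delta-method step: asymptotic normality of `ΔF̂_n = −log ((1/n) Σ w)` -/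

/-- The difference quotient of `log` at `θ`, extended by `θ⁻¹` at `θ` (Mathlib's `dslope`), is
measurable. -/
theorem measurable_dslope_log (θ : ℝ) : Measurable (dslope Real.log θ) := by
  have h : dslope Real.log θ = fun b => if b = θ then deriv Real.log θ else
      (Real.log b - Real.log θ) / (b - θ) := by
    funext b
    by_cases hb : b = θ
    · rw [hb, if_pos rfl, dslope_same]
    · rw [if_neg hb, dslope_of_ne _ hb, slope_def_field]
  rw [h]
  refine Measurable.ite ?_ measurable_const ?_
  · exact (measurableSet_singleton θ : MeasurableSet {b : ℝ | b = θ})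
  · exact (Real.measurable_log.sub measurable_const).div (measurable_id.sub measurable_const)

omit [IsProbabilityMeasure P'] in
/-- Rescaling a centred Gaussian variable: if `Y ~ N(0, (v/θ²)⁺)` with `v ≥ 0`, `θ ≠ 0` and
`c² = θ²`, then `c·Y ~ N(0, v⁺)`. -/
theorem hasLaw_const_mul_gaussianReal {v θ c : ℝ} (hv : 0 ≤ v) (hθ : θ ≠ 0) (hc : c ^ 2 = θ ^ 2)
    {Y : Ω' → ℝ} (hY : HasLaw Y (gaussianReal 0 (v / θ ^ 2).toNNReal) P') :
    HasLaw (fun ω' => c * Y ω') (gaussianReal 0 v.toNNReal) P' := by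
  have h := gaussianReal_const_mul hY c
  rw [mul_zero] at h
  convert h using 3
  apply NNReal.eq
  have hθ2 : 0 < θ ^ 2 := by positivity
  rw [NNReal.coe_mul, NNReal.coe_mk, Real.coe_toNNReal _ hv,
    Real.coe_toNNReal _ (div_nonneg hv hθ2.le), hc, mul_div_cancel₀ _ hθ2.ne']

/-- **The delta-method step (asymptotic normality of the Jarzynski estimate).**  For a positive
measurable weight `w ∈ L²(μ)` with mean `θ = E_μ w`, along an infinite i.i.d. run
`√n (ΔF̂_n − (−log θ)) = √n (−log ((1/n) Σ_{i<n} w(ω i)) + log θ)` converges in distribution to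
the centred Gaussian of variance `Var_μ[w] / θ²` (the squared coefficient of variation of the
weight).  Proof: the CLT for the sample mean, `log Ȳ − log θ = (Ȳ − θ) · dslope log θ Ȳ`, the
strong law `Ȳ_n → θ` a.s. with continuity of `dslope log θ` at `θ` (value `θ⁻¹`), and Slutsky's
theorem (`TendstoInDistribution.continuous_comp_prodMk_of_tendstoInMeasure_const`). -/
theorem tendstoInDistribution_sqrt_mul_jarzynskiEstimate_sub {w : E → ℝ} (hwm : Measurable w)
    (hwpos : ∀ a, 0 < w a) (hL2 : MemLp w 2 μ) {Y : Ω' → ℝ}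
    (hY : HasLaw Y (gaussianReal 0 (Var[w; μ] / (∫ a, w a ∂μ) ^ 2).toNNReal) P') :
    TendstoInDistribution
      (fun (n : ℕ) (ω : ℕ → E) =>
        √(n : ℝ) * (jarzynskiEstimate w (fun i : Fin n => ω i) - -Real.log (∫ a, w a ∂μ)))
      atTop Y (fun _ => Measure.infinitePi fun _ : ℕ => μ) P' := by
  set θ := ∫ a, w a ∂μ with hθdef
  have hwi : Integrable w μ := hL2.integrable one_le_two
  have hθ : 0 < θ := by
    rw [hθdef, integral_pos_iff_support_of_nonneg (fun a => (hwpos a).le) hwi]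
    have hsupp : Function.support w = univ := by
      ext a
      simp only [Function.mem_support, mem_univ, iff_true]
      exact (hwpos a).ne'
    rw [hsupp, measure_univ]
    exact one_pos
  -- the CLT for the sample mean, against `Y₀ = −θ·Y ~ N(0, Var w)`
  have hY₀ := hasLaw_const_mul_gaussianReal (variance_nonneg w μ) hθ.ne' (neg_sq θ) hY
  have clt := tendstoInDistribution_sqrt_mul_sampleMean_sub μ hwm hL2 hY₀
  -- the slope factor converges in probability to `θ⁻¹`
  have hBmeas : ∀ n, AEMeasurable (fun ω : ℕ → E =>
      dslope Real.log θ (sampleMean w fun i : Fin n => ω i)) (Measure.infinitePi fun _ : ℕ => μ) :=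
    fun n => ((measurable_dslope_log θ).comp (measurable_sampleMean_run hwm n)).aemeasurable
  have hB : TendstoInMeasure (Measure.infinitePi fun _ : ℕ => μ)
      (fun n (ω : ℕ → E) => dslope Real.log θ (sampleMean w fun i : Fin n => ω i)) atTop
      (fun _ => θ⁻¹) := by
    refine tendstoInMeasure_of_tendsto_ae (fun n => (hBmeas n).aestronglyMeasurable) ?_
    filter_upwards [tendsto_sampleMean_ae μ hwm hwi] with ω hω
    have hcont : ContinuousAt (dslope Real.log θ) θ :=
      continuousAt_dslope_same.2 (Real.differentiableAt_log hθ.ne')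
    have hval : dslope Real.log θ θ = θ⁻¹ := by rw [dslope_same, Real.deriv_log]
    rw [← hval]
    exact hcont.tendsto.comp hω
  have slutsky := clt.continuous_comp_prodMk_of_tendstoInMeasure_const
    (g := fun p : ℝ × ℝ => -(p.2 * p.1)) (by fun_prop) hB hBmeas
  have hlim : (fun ω' => -(θ⁻¹ * (-θ * Y ω'))) = Y := by
    funext ω'
    field_simp
  simp only at slutsky
  rw [hlim] at slutsky
  convert slutsky using 3 with n ω
  have key := sub_smul_dslope Real.log θ (sampleMean w fun i : Fin n => ω i)
  rw [smul_eq_mul] at key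
  unfold jarzynskiEstimate
  linear_combination √(n : ℝ) * key

end IID

/-! ## For a Crooks pair: the exponential average and `ΔF̂_n` are asymptotically normal -/

namespace CrooksPair

variable {Ω : Type*} [MeasurableSpace Ω]
variable {ν₀ ν₁ : Measure Ω} {κF κR : Kernel Ω E} {s e : E → Ω} {W : E → ℝ}
variable {Ω' : Type*} [MeasurableSpace Ω'] {P' : Measure Ω'} [IsProbabilityMeasure P']

/-- **CLT for the exponential average of a Crooks pair.**  Along an infinite run of independent
forward evolutions from prior equilibrium (law `Measure.infinitePi (fun _ => P_F)`), with
`e^{−W} ∈ L²(P_F)` (i.e. `E_F e^{−2W} < ∞`),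
`√n ((1/n) Σ_{i<n} e^{−W_i} − Z₁/Z₀) →d N(0, E_F[e^{−2W}] − (Z₁/Z₀)²)`. -/
theorem tendstoInDistribution_sampleMean_exp_neg_work [IsFiniteMeasure ν₀] [IsMarkovKernel κF]
    [IsMarkovKernel κR] (h0 : ν₀ univ ≠ 0) (h : CrooksPair ν₀ ν₁ κF κR s e W)
    (hL2 : MemLp (fun ε => Real.exp (-W ε)) 2 (fwdPathLaw ν₀ κF)) {Y : Ω' → ℝ}
    (hY : HasLaw Y (gaussianReal 0 (∫ ε, Real.exp (-(2 * W ε)) ∂(fwdPathLaw ν₀ κF) -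
      ((ν₀ univ)⁻¹ * ν₁ univ).toReal ^ 2).toNNReal) P') :
    haveI := isProbabilityMeasure_fwdPathLaw ν₀ h0 κF
    TendstoInDistribution
      (fun (n : ℕ) (ω : ℕ → E) => √(n : ℝ) *
        (sampleMean (fun ε => Real.exp (-W ε)) (fun i : Fin n => ω i) - ((ν₀ univ)⁻¹ * ν₁ univ).toReal))
      atTop Y (fun _ => Measure.infinitePi fun _ : ℕ => fwdPathLaw ν₀ κF) P' := by
  haveI := isProbabilityMeasure_fwdPathLaw ν₀ h0 κF
  rw [← h.variance_exp_neg_work h0 hL2] at hY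
  have clt := tendstoInDistribution_sqrt_mul_sampleMean_sub (fwdPathLaw ν₀ κF)
    (g := fun ε => Real.exp (-W ε)) (Real.measurable_exp.comp h.measurable_W.neg) hL2 hY
  rwa [h.integral_exp_neg_work] at clt

/-- **Asymptotic normality of `ΔF̂` with asymptotic variance `1/ESS_F − 1`.**  For every Crooks pair
on a general measurable state space with `e^{−W} ∈ L²(P_F)` and `e^{−ΔF} = Z₁/Z₀`, along an
infinite run of independent forward evolutions
`√n (ΔF̂_n − ΔF) →d N(0, E_F[e^{−2W}] / (E_F e^{−W})² − 1)`, and the variance is `1/ESS_F − 1`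
(`NCMCGeneralSpaceDissipation.essPop_eq_inv_dissipation`: `ESS_F = 1/E_F e^{−2(W − ΔF)}`;
`NCMCGeneralSpaceEstimatorConsistency.variance_exp_neg_work_div_sq`).  The reported `ess` is thus
the asymptotic relative efficiency of `dF`: `n · Var(ΔF̂_n) → 1/ESS_F − 1`-shaped error bars are
what an honest `dF ± err` means for independent evolutions. -/
theorem tendstoInDistribution_jarzynskiEstimate [IsFiniteMeasure ν₀] [IsFiniteMeasure ν₁]
    [IsMarkovKernel κF] [IsMarkovKernel κR] (h0 : ν₀ univ ≠ 0) (h1 : ν₁ univ ≠ 0)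
    (h : CrooksPair ν₀ ν₁ κF κR s e W)
    (hL2 : MemLp (fun ε => Real.exp (-W ε)) 2 (fwdPathLaw ν₀ κF)) {ΔF : ℝ}
    (hΔF : Real.exp (-ΔF) = ((ν₀ univ)⁻¹ * ν₁ univ).toReal) {Y : Ω' → ℝ}
    (hY : HasLaw Y (gaussianReal 0 ((∫ ε, Real.exp (-(2 * W ε)) ∂(fwdPathLaw ν₀ κF)) /
      (∫ ε, Real.exp (-W ε) ∂(fwdPathLaw ν₀ κF)) ^ 2 - 1).toNNReal) P') :
    haveI := isProbabilityMeasure_fwdPathLaw ν₀ h0 κF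
    TendstoInDistribution
      (fun (n : ℕ) (ω : ℕ → E) => √(n : ℝ) *
        (jarzynskiEstimate (fun ε => Real.exp (-W ε)) (fun i : Fin n => ω i) - ΔF))
      atTop Y (fun _ => Measure.infinitePi fun _ : ℕ => fwdPathLaw ν₀ κF) P' := by
  haveI := isProbabilityMeasure_fwdPathLaw ν₀ h0 κF
  rw [← h.variance_exp_neg_work_div_sq h0 h1 hL2] at hY
  have dm := tendstoInDistribution_sqrt_mul_jarzynskiEstimate_sub (fwdPathLaw ν₀ κF)
    (w := fun ε => Real.exp (-W ε)) (Real.measurable_exp.comp h.measurable_W.neg)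
    (fun ε => Real.exp_pos _) hL2 hY
  rwa [h.integral_exp_neg_work, ← hΔF, Real.log_exp, neg_neg] at dm

/-- **The same, with the variance written as the second exponential moment of the dissipated work**:
`√n (ΔF̂_n − ΔF) →d N(0, E_F[e^{−2(W − ΔF)}] − 1)` — i.e. `N(0, 1/ESS_F − 1)` with row 13's
`ESS_F = 1/⟨e^{−2W_d}⟩_F`. -/
theorem tendstoInDistribution_jarzynskiEstimate_dissipation [IsFiniteMeasure ν₀] [IsFiniteMeasure ν₁]
    [IsMarkovKernel κF] [IsMarkovKernel κR] (h0 : ν₀ univ ≠ 0) (h1 : ν₁ univ ≠ 0)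
    (h : CrooksPair ν₀ ν₁ κF κR s e W)
    (hL2 : MemLp (fun ε => Real.exp (-W ε)) 2 (fwdPathLaw ν₀ κF)) {ΔF : ℝ}
    (hΔF : Real.exp (-ΔF) = ((ν₀ univ)⁻¹ * ν₁ univ).toReal) {Y : Ω' → ℝ}
    (hY : HasLaw Y (gaussianReal 0
      ((∫ ε, Real.exp (-(2 * (W ε - ΔF))) ∂(fwdPathLaw ν₀ κF)) - 1).toNNReal) P') :
    haveI := isProbabilityMeasure_fwdPathLaw ν₀ h0 κF
    TendstoInDistribution
      (fun (n : ℕ) (ω : ℕ → E) => √(n : ℝ) *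
        (jarzynskiEstimate (fun ε => Real.exp (-W ε)) (fun i : Fin n => ω i) - ΔF))
      atTop Y (fun _ => Measure.infinitePi fun _ : ℕ => fwdPathLaw ν₀ κF) P' := by
  have key : (∫ ε, Real.exp (-(2 * W ε)) ∂(fwdPathLaw ν₀ κF)) /
      (∫ ε, Real.exp (-W ε) ∂(fwdPathLaw ν₀ κF)) ^ 2 =
      ∫ ε, Real.exp (-(2 * (W ε - ΔF))) ∂(fwdPathLaw ν₀ κF) := by
    rw [← inv_div, h.essPop_eq_inv_dissipation h0 h1 hΔF, one_div, inv_inv]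
  rw [← key] at hY
  exact h.tendstoInDistribution_jarzynskiEstimate h0 h1 hL2 hΔF hY

end CrooksPair

end Summit.Ventures.LatticeQCDFlow.Exactness.GeneralNCMC
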